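import Literature.AnabelianGeometry.SemiGraphs.TemperedReconstructionR0Refutation
import HarnessLib

/-!
# The metabelian leaves `ℤ_p ⋊ ⟨1 + p^{n+1}⟩‾` inside the Iwahori witness group («RAYLESS-STAR·CIV-NEG»,
# brick S2: the LEAF GROUPS)

Mochizuki, *Semi-graphs of anabelioids*, Publ. RIMS **42** (2006), Def. 2.1 p. 22 (vertex groups, branch
maps), Def. 2.4 (ii) p. 25 (verticially slim), Def. 2.4 (iv) p. 26 (estranged / malnormal branch groups)
[cite: MochizukiSemiAnbd2006, Def 2.4 p.25-26]; the group-theoretic facts are elementary computations in the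
tree's concrete pro-`p` group `Iw p = ℤ_p ⋊ (1 + pℤ_p)` of abc-iut-w5-d236 (`WitnessIwahoriGroup.lean`,
coordinates `(a, s)`, `u = 1 + p s`), cf. Ribes–Zalesskii, *Profinite Groups*, §4.1 for `ℤ_p`-powers
[cite: RibesZalesskii2010, §4.1].

abc-iut cell, layer L3, row «RAYLESS-STAR·CIV-NEG» (L3-lead β77 (2); seat abc-iut-L3-t8 gen 6; desk memo
`HOME/staging/L3/L3-t8/g6/VERTICAL-ESCAPE-RAYLESS-STAR-L3t8g6.md` §1/§8 (k1)).  HONEST FRAMING: pure group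
theory; the leaves of the rayless counter-carrier `𝒢⋆` are realised WITHOUT new `p`-adic analysis as CLOSED
SUBGROUPS of `Iw p`:

* `IwU.gen n = ⟨p^n⟩` — the unit `u_n = 1 + p^{n+1}` of `U = 1 + pℤ_p`; `IwU.C n = ⟨u_n⟩‾` its closed procyclic
  subgroup (infinite); `IwU.zpowGen n : ℤ_p → U`, `t ↦ u_nᵗ` (from abc-iut-w6-d099's `IwU.exists_zpow`), with
  range `C n`, INJECTIVE;
* `Iw.Leaf n = ℤ_p ⋊ C n ≤ Iw p` (the preimage of `C n` under `(a, s) ↦ s`), a closed — hence profinite —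
  subgroup containing the translation `transl = (1, 0)` and `sig n = (0, p^n)`;
* `Iw.lowHom n : ℤ_p → Leaf n`, `t ↦ (0, ·)`-torus powers of `sig n` — the LEAF GLUING of `𝒢⋆`; injective,
  range `B_n` = the elements of `Leaf n` with `a = 0` (`mem_range_lowHom_iff`);
* `B_n` is MALNORMAL in `Leaf n` (`range_lowHom_inf_conj_eq_bot`, from w5-d236's torus malnormality), infinite,
  of relative index `0` against its foreign conjugates (slimness of `Leaf n`: companion file
  `IwahoriMetabelianLeavesSlim.lean`);
* the ENGINE of the vertical escape: `sig n * transl * (sig n)⁻¹ = transl ^ (1 + p^{n+1})` — the malnormality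
  modulus of `B_n ≤ Leaf n` degrades with `n` (`toMod_conj_transl_eq` : modulo level `m ≤ n + 1` the elements
  `sig n` and `transl` commute).

Definitions + elementary properties; one instance (`CompactSpace` of the leaf subgroup types, as in
`WitnessIwahoriGroup.lean`); no named fact; no side taken on [IUTchIII] Cor 3.12.
-/

noncomputable section

open Topology Multiplicative

namespace Literature.AnabelianGeometry.SemiGraphs

open IwahoriWitness

variable {p : ℕ} [hp : Fact p.Prime]

/-! ## 1. The units `u_n = 1 + p^{n+1}` and the closed procyclic subgroups `C_n = ⟨u_n⟩‾ ≤ U` -/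

namespace IwU

/-- `u_n := 1 + p^{n+1} ∈ U = 1 + pℤ_p`, i.e. the element of coordinate `s = p^n`.
[cite: MochizukiSemiAnbd2006, §2 p.23] -/
def gen (n : ℕ) : IwU p := ⟨(p : ℤ_[p]) ^ n⟩

/-- Coordinate of `u_n`. [cite: MochizukiSemiAnbd2006, §2 p.23] -/
@[simp] theorem gen_s (n : ℕ) : (gen (p := p) n).s = (p : ℤ_[p]) ^ n := rfl

/-- `u_n = 1 + p^{n+1}` as an element of `ℤ_p`. [cite: MochizukiSemiAnbd2006, §2 p.23] -/
theorem w_gen_s (n : ℕ) : w p (gen (p := p) n).s = 1 + (p : ℤ_[p]) ^ (n + 1) := by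
  simp [w, pow_succ, mul_comm]

/-- `u_n ^ k ≠ 1` for `k ≠ 0`: `(1 + p^{n+1})^k ≠ 1` already in `ℕ`. [cite: RibesZalesskii2010, §4.1] -/
theorem gen_pow_ne_one (n : ℕ) {k : ℕ} (hk : k ≠ 0) : gen (p := p) n ^ k ≠ 1 := by
  intro h
  have h1 : w p ((gen (p := p) n) ^ k).s = 1 := by rw [h]; simp [w]
  rw [w_pow, w_gen_s] at h1
  have h2 : (((1 + p ^ (n + 1)) ^ k : ℕ) : ℤ_[p]) = ((1 : ℕ) : ℤ_[p]) := by push_cast; exact h1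
  have h3 : (1 + p ^ (n + 1)) ^ k = 1 := Nat.cast_injective h2
  have h4 : 1 < (1 + p ^ (n + 1)) ^ k :=
    Nat.one_lt_pow hk (Nat.lt_add_of_pos_right (pow_pos hp.out.pos _))
  omega

/-- `u_n` has infinite order. [cite: RibesZalesskii2010, §4.1] -/
theorem not_isOfFinOrder_gen (n : ℕ) : ¬ IsOfFinOrder (gen (p := p) n) := by
  rw [isOfFinOrder_iff_pow_eq_one]
  rintro ⟨k, hk, h⟩
  exact gen_pow_ne_one n (Nat.pos_iff_ne_zero.mp hk) h

/-- `C_n := ⟨u_n⟩‾`, the closure of the cyclic subgroup generated by `u_n`.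
[cite: MochizukiSemiAnbd2006, §2 p.23] -/
def C (n : ℕ) : Subgroup (IwU p) := (Subgroup.zpowers (gen (p := p) n)).topologicalClosure

/-- `C_n` is closed. [cite: MochizukiSemiAnbd2006, §2 p.23] -/
theorem isClosed_C (n : ℕ) : IsClosed (C (p := p) n : Set (IwU p)) :=
  Subgroup.isClosed_topologicalClosure _

/-- `u_n ∈ C_n`. [cite: MochizukiSemiAnbd2006, §2 p.23] -/
theorem gen_mem_C (n : ℕ) : gen (p := p) n ∈ C n :=
  Subgroup.le_topologicalClosure _ (Subgroup.mem_zpowers _)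

/-- `C_n` is infinite (its generator has infinite order). [cite: RibesZalesskii2010, §4.1] -/
theorem infinite_C (n : ℕ) : (C (p := p) n : Set (IwU p)).Infinite :=
  Set.infinite_of_injective_forall_mem (injective_zpow_iff_not_isOfFinOrder.2 (not_isOfFinOrder_gen n))
    fun k => Subgroup.le_topologicalClosure _ (Subgroup.mem_zpowers_iff.2 ⟨k, rfl⟩)

/-- **`ℤ_p`-powers of `u_n`**: the continuous homomorphism `ℤ_p → U`, `1 ↦ u_n` (abc-iut-w6-d099's
`IwU.exists_zpow`, universal property of the pro-`p` completion `ℤ → ℤ_p` towards the pro-`p` group `U`).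
[cite: RibesZalesskii2010, §4.1] -/
def zpowGen (n : ℕ) : Multiplicative ℤ_[p] →ₜ* IwU p := (exists_zpow (gen (p := p) n)).choose

/-- `zpowGen n 1 = u_n`. [cite: RibesZalesskii2010, §4.1] -/
@[simp] theorem zpowGen_ofAdd_one (n : ℕ) : zpowGen (p := p) n (ofAdd 1) = gen n :=
  (exists_zpow (gen (p := p) n)).choose_spec

/-- `zpowGen n m = u_n ^ m` for `m ∈ ℤ`. [cite: RibesZalesskii2010, §4.1] -/
theorem zpowGen_ofAdd_intCast (n : ℕ) (m : ℤ) : zpowGen (p := p) n (ofAdd (m : ℤ_[p])) = gen n ^ m := by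
  rw [FreeProPRankTwo.ofAdd_intCast_eq_pow p, map_zpow, zpowGen_ofAdd_one]

/-- `zpowGen n m = u_n ^ m` for `m ∈ ℕ`. [cite: RibesZalesskii2010, §4.1] -/
theorem zpowGen_ofAdd_natCast (n : ℕ) (m : ℕ) : zpowGen (p := p) n (ofAdd (m : ℤ_[p])) = gen n ^ m := by
  have h := zpowGen_ofAdd_intCast (p := p) n m
  rwa [Int.cast_natCast, zpow_natCast] at h

/-- **The range of `zpowGen n` is `C_n`.** [cite: RibesZalesskii2010, §4.1] -/
theorem range_zpowGen (n : ℕ) : (zpowGen (p := p) n).toMonoidHom.range = C n := by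
  apply le_antisymm
  · rintro _ ⟨t, rfl⟩
    have ht : t ∈ closure ((Subgroup.zpowers (ofAdd (1 : ℤ_[p]))) : Set (Multiplicative ℤ_[p])) := by
      rw [← Subgroup.topologicalClosure_coe, FreeProPRankTwo.topologicalClosure_zpowers_ofAdd_one p]
      trivial
    have himg := image_closure_subset_closure_image (zpowGen (p := p) n).continuous ⟨t, ht, rfl⟩
    change zpowGen n t ∈ ((C n : Subgroup (IwU p)) : Set (IwU p))
    rw [C, Subgroup.topologicalClosure_coe]
    refine closure_mono ?_ himg
    rintro _ ⟨_, ⟨m, rfl⟩, rfl⟩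
    refine ⟨m, ?_⟩
    change gen n ^ m = zpowGen n (ofAdd (1 : ℤ_[p]) ^ m)
    rw [map_zpow, zpowGen_ofAdd_one]
  · refine Subgroup.topologicalClosure_minimal _ ?_ ?_
    · rintro _ ⟨m, rfl⟩
      exact ⟨ofAdd (m : ℤ_[p]), zpowGen_ofAdd_intCast n m⟩
    · exact (isCompact_range (zpowGen (p := p) n).continuous).isClosed

/-- `zpowGen n t ∈ C_n`. [cite: RibesZalesskii2010, §4.1] -/
theorem zpowGen_mem_C (n : ℕ) (t : Multiplicative ℤ_[p]) : zpowGen (p := p) n t ∈ C n := by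
  rw [← range_zpowGen]
  exact ⟨t, rfl⟩

/-- A closed subgroup of `ℤ_p` (written multiplicatively) containing `t ≠ 0` contains `p ^ v(t)`: multiply by
the inverse of the unit coefficient, a limit of integers. [cite: RibesZalesskii2010, §4.1] -/
theorem ofAdd_pow_valuation_mem_of_mem {K : Subgroup (Multiplicative ℤ_[p])}
    (hK : IsClosed (K : Set (Multiplicative ℤ_[p])))
    {t : ℤ_[p]} (ht : t ≠ 0) (htK : ofAdd t ∈ K) : ofAdd ((p : ℤ_[p]) ^ t.valuation) ∈ K := by
  -- `p ^ v(t) = t * u⁻¹` for the unit coefficient `u`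
  set u : ℤ_[p]ˣ := PadicInt.unitCoeff ht with hu
  have hpt : (p : ℤ_[p]) ^ t.valuation = t * (u⁻¹ : ℤ_[p]ˣ) := by
    rw [Units.eq_mul_inv_iff_mul_eq, mul_comm]
    exact (PadicInt.unitCoeff_spec ht).symm
  -- integers are dense: `u⁻¹` is a limit of integers, and `t * k ∈ K` for every integer `k`
  have hmemZ : ∀ k : ℤ, ofAdd (t * (k : ℤ_[p])) ∈ K := fun k => by
    have : ofAdd (t * (k : ℤ_[p])) = (ofAdd t) ^ k := by
      rw [← ofAdd_zsmul, zsmul_eq_mul, mul_comm]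
    rw [this]
    exact K.zpow_mem htK k
  have hcl : ofAdd (t * ((u⁻¹ : ℤ_[p]ˣ) : ℤ_[p])) ∈ closure (K : Set (Multiplicative ℤ_[p])) := by
    have hcont : Continuous fun z : ℤ_[p] => ofAdd (t * z) := continuous_ofAdd.comp (continuous_const.mul continuous_id)
    have hdense := PadicInt.denseRange_intCast (p := p)
    have hx : ((u⁻¹ : ℤ_[p]ˣ) : ℤ_[p]) ∈ closure (Set.range (Int.cast : ℤ → ℤ_[p])) := by
      rw [hdense.closure_range]; trivial
    have himg := image_closure_subset_closure_image hcont ⟨_, hx, rfl⟩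
    refine closure_mono ?_ himg
    rintro _ ⟨_, ⟨k, rfl⟩, rfl⟩
    exact hmemZ k
  rw [hK.closure_eq] at hcl
  rw [hpt]
  exact hcl

/-- **`zpowGen n` is injective** (a non-trivial element of the kernel would put some `p^j` in it, but
`u_n^{p^j} ≠ 1`). [cite: RibesZalesskii2010, §4.1] -/
theorem zpowGen_injective (n : ℕ) : Function.Injective (zpowGen (p := p) n) := by
  refine (injective_iff_map_eq_one (zpowGen (p := p) n)).2 fun x hx => ?_
  by_contra hne
  have ht : x.toAdd ≠ 0 := fun h => hne (by rw [← ofAdd_toAdd x, h]; rfl)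
  have hK : IsClosed (((zpowGen (p := p) n).toMonoidHom.ker : Subgroup _) : Set (Multiplicative ℤ_[p])) := by
    rw [MonoidHom.coe_ker]
    exact (isClosed_singleton (x := (1 : IwU p))).preimage (zpowGen (p := p) n).continuous
  have hmem := ofAdd_pow_valuation_mem_of_mem hK ht (by rw [ofAdd_toAdd]; exact hx)
  rw [MonoidHom.mem_ker] at hmem
  have h2 : zpowGen (p := p) n (ofAdd (((p ^ x.toAdd.valuation : ℕ) : ℤ_[p]))) = 1 := by
    rw [Nat.cast_pow]; exact hmem
  rw [zpowGen_ofAdd_natCast] at h2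
  exact gen_pow_ne_one n (pow_ne_zero _ hp.out.ne_zero) h2

end IwU

/-! ## 2. The leaves `Leaf n = ℤ_p ⋊ C_n ≤ P` -/

namespace Iw

/-- The projection `P → U`, `(a, s) ↦ s` (a continuous homomorphism). [cite: MochizukiSemiAnbd2006, §2 p.23] -/
def projU : Iw p →ₜ* IwU p where
  toFun x := ⟨x.s⟩
  map_one' := rfl
  map_mul' _ _ := rfl
  continuous_toFun := (IwU.continuous_mk_iff (p := p)).2 continuous_s

/-- Coordinate of the projection. [cite: MochizukiSemiAnbd2006, §2 p.23] -/
@[simp] theorem projU_s (x : Iw p) : (projU x).s = x.s := rfl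

/-- **The leaf group** `Leaf n := ℤ_p ⋊ C_n = {(a, s) : 1 + p s ∈ ⟨1 + p^{n+1}⟩‾}`, a subgroup of `P`.
[cite: MochizukiSemiAnbd2006, Def 2.1 p.22] -/
def Leaf (n : ℕ) : Subgroup (Iw p) := (IwU.C n).comap (projU (p := p)).toMonoidHom

/-- Membership in the leaf group. [cite: MochizukiSemiAnbd2006, Def 2.1 p.22] -/
theorem mem_leaf_iff (n : ℕ) (x : Iw p) : x ∈ Leaf n ↔ (⟨x.s⟩ : IwU p) ∈ IwU.C n := Iff.rfl

/-- The leaf group is closed in `P`. [cite: MochizukiSemiAnbd2006, Def 2.1 p.22] -/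
theorem isClosed_leaf (n : ℕ) : IsClosed (Leaf (p := p) n : Set (Iw p)) :=
  (IwU.isClosed_C n).preimage (projU (p := p)).continuous

/-- The leaf group is compact (a closed subgroup of the profinite `P`); recorded as an instance on the
subgroup type, the vertex group of the leaf. [cite: MochizukiSemiAnbd2006, Def 2.1 p.22] -/
instance compactSpace_leaf (n : ℕ) : CompactSpace (Leaf (p := p) n) :=
  isCompact_iff_compactSpace.mp (isClosed_leaf n).isCompact

/-- The translation `transl = (1, 0) ∈ P`. [cite: MochizukiSemiAnbd2006, §2 p.23] -/
def transl : Iw p := ⟨1, 0⟩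

/-- Coordinates of the translation. [cite: MochizukiSemiAnbd2006, §2 p.23] -/
@[simp] theorem transl_a : (transl (p := p)).a = 1 := rfl
/-- Coordinates of the translation. [cite: MochizukiSemiAnbd2006, §2 p.23] -/
@[simp] theorem transl_s : (transl (p := p)).s = 0 := rfl

/-- Powers of the translation: `transl ^ k = (k, 0)`. [cite: MochizukiSemiAnbd2006, §2 p.23] -/
theorem transl_pow (k : ℕ) : (transl (p := p)) ^ k = ⟨(k : ℤ_[p]), 0⟩ := by
  induction k with
  | zero => rfl
  | succ k ih =>
    rw [pow_succ, ih]
    ext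
    · simp [w]
    · simp

/-- `transl ∈ Leaf n` (its unit coordinate is `1 ∈ C_n`). [cite: MochizukiSemiAnbd2006, §2 p.23] -/
theorem transl_mem_leaf (n : ℕ) : transl (p := p) ∈ Leaf n := by
  rw [mem_leaf_iff]
  exact (IwU.C n).one_mem

/-- `sig n := (0, p^n) = b_0(u_n)`, the torus element of the leaf above `u_n`. [cite: MochizukiSemiAnbd2006, §2 p.23] -/
def sig (n : ℕ) : Iw p := bHom 0 (IwU.gen n)

/-- Coordinates of `sig n`. [cite: MochizukiSemiAnbd2006, §2 p.23] -/
@[simp] theorem sig_a (n : ℕ) : (sig (p := p) n).a = 0 := by simp [sig]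
/-- Coordinates of `sig n`. [cite: MochizukiSemiAnbd2006, §2 p.23] -/
@[simp] theorem sig_s (n : ℕ) : (sig (p := p) n).s = (p : ℤ_[p]) ^ n := by simp [sig]

/-- `b_0 u ∈ Leaf n ↔ u ∈ C_n`. [cite: MochizukiSemiAnbd2006, §2 p.23] -/
theorem bHom_zero_mem_leaf_iff (n : ℕ) (u : IwU p) : bHom 0 u ∈ Leaf (p := p) n ↔ u ∈ IwU.C n := by
  rw [mem_leaf_iff]
  rfl

/-- `sig n ∈ Leaf n`. [cite: MochizukiSemiAnbd2006, §2 p.23] -/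
theorem sig_mem_leaf (n : ℕ) : sig (p := p) n ∈ Leaf n :=
  (bHom_zero_mem_leaf_iff n _).2 (IwU.gen_mem_C n)

/-- **The engine**: `sig n · transl · (sig n)⁻¹ = transl ^ (1 + p^{n+1})` — conjugation by the branch
generator raises the translation to the power `u_n = 1 + p^{n+1}`. [cite: MochizukiSemiAnbd2006, Def 2.4(iv) p.26] -/
theorem sig_mul_transl_mul_sig_inv (n : ℕ) :
    sig (p := p) n * transl * (sig n)⁻¹ = transl ^ (1 + p ^ (n + 1)) := by
  obtain ⟨hs, ha⟩ := conj_coords (sig (p := p) n) transl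
  rw [transl_pow]
  ext
  · rw [ha]
    simp [w, pow_succ, mul_comm]
  · rw [hs]
    simp

/-- The commutator `[sig n, transl] = transl ^ (p^{n+1})` lies in the `p^{n+1}`-th powers of the translations.
[cite: MochizukiSemiAnbd2006, Def 2.4(iv) p.26] -/
theorem sig_mul_transl_mul_sig_inv_mul_transl_inv (n : ℕ) :
    sig (p := p) n * transl * (sig n)⁻¹ * transl⁻¹ = transl ^ (p ^ (n + 1)) := by
  rw [sig_mul_transl_mul_sig_inv, add_comm, pow_succ, mul_inv_cancel_right]

/-- Modulo level `m ≤ n + 1` the branch generator and the translation COMMUTE (the image of the commutator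
`transl ^ (p^{n+1})` in `P_m` is trivial): the malnormality modulus of the leaf degrades with `n`.
[cite: MochizukiSemiAnbd2006, Def 2.3(i) p.24] -/
theorem toMod_transl_pow_eq_one {m n : ℕ} (h : m ≤ n + 1) :
    toMod m ((transl (p := p)) ^ (p ^ (n + 1))) = 1 := by
  haveI : NeZero (p ^ m) := ⟨pow_ne_zero _ hp.out.ne_zero⟩
  rw [transl_pow]
  ext
  · rw [toMod_a, IwMod.one_a, map_natCast]
    exact (ZMod.natCast_eq_zero_iff _ _).2 (pow_dvd_pow p h)
  · rw [toMod_s, IwMod.one_s, map_zero]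

/-! ## 3. The leaf gluing `lowHom n : ℤ_p → Leaf n` and its range `B_n` -/

/-- **The leaf gluing** `ℤ_p → Leaf n`, `t ↦ b_0(u_nᵗ) = (0, ·)`: the branch map of `𝒢⋆` at the leaf `n`.
[cite: MochizukiSemiAnbd2006, Def 2.1 p.22] -/
def lowHom (n : ℕ) : Multiplicative ℤ_[p] →ₜ* Leaf (p := p) n where
  toFun t := ⟨bHom 0 (IwU.zpowGen n t), (bHom_zero_mem_leaf_iff n _).2 (IwU.zpowGen_mem_C n t)⟩
  map_one' := by ext1; simp
  map_mul' x y := by ext1; simp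
  continuous_toFun := ((bHom (0 : ℤ_[p])).continuous.comp (IwU.zpowGen (p := p) n).continuous).subtype_mk _

/-- The leaf gluing in `P`-coordinates. [cite: MochizukiSemiAnbd2006, Def 2.1 p.22] -/
@[simp] theorem coe_lowHom (n : ℕ) (t : Multiplicative ℤ_[p]) :
    ((lowHom (p := p) n t : Leaf (p := p) n) : Iw p) = bHom 0 (IwU.zpowGen n t) := rfl

/-- `lowHom n 1 = sig n`. [cite: MochizukiSemiAnbd2006, Def 2.1 p.22] -/
theorem coe_lowHom_ofAdd_one (n : ℕ) : ((lowHom (p := p) n (ofAdd 1) : Leaf (p := p) n) : Iw p) = sig n := by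
  rw [coe_lowHom, IwU.zpowGen_ofAdd_one]
  rfl

/-- **The leaf gluing is injective** (`b_0` and `zpowGen n` are). [cite: MochizukiSemiAnbd2006, Def 2.1 p.22] -/
theorem lowHom_injective (n : ℕ) : Function.Injective (lowHom (p := p) n) := fun x y h => by
  have h' := congrArg (fun z : Leaf (p := p) n => (z : Iw p)) h
  simp only [coe_lowHom] at h'
  exact IwU.zpowGen_injective n (bHom_injective 0 h')

/-- Elements of the range `B_n` of the leaf gluing lie in the torus `T_0`. [cite: MochizukiSemiAnbd2006, §2 p.23] -/
theorem coe_mem_range_bHom_zero_of_mem_range {n : ℕ} {x : Leaf (p := p) n}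
    (hx : x ∈ (lowHom (p := p) n).toMonoidHom.range) : (x : Iw p) ∈ (bHom (0 : ℤ_[p])).toMonoidHom.range := by
  obtain ⟨t, rfl⟩ := hx
  exact ⟨IwU.zpowGen n t, rfl⟩

/-- **`B_n` in coordinates**: an element of `Leaf n` lies in the range of the leaf gluing iff its
translation coordinate vanishes. [cite: MochizukiSemiAnbd2006, §2 p.23] -/
theorem mem_range_lowHom_iff {n : ℕ} (x : Leaf (p := p) n) :
    x ∈ (lowHom (p := p) n).toMonoidHom.range ↔ (x : Iw p).a = 0 := by
  constructor
  · intro hx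
    have h := (mem_range_bHom_iff 0 (x : Iw p)).1 (coe_mem_range_bHom_zero_of_mem_range hx)
    rw [h, zero_mul]
  · intro ha
    have hC : (⟨(x : Iw p).s⟩ : IwU p) ∈ IwU.C n := (mem_leaf_iff n _).1 x.2
    rw [← IwU.range_zpowGen] at hC
    obtain ⟨t, ht⟩ := hC
    have ht' : IwU.zpowGen n t = ⟨(x : Iw p).s⟩ := ht
    refine ⟨t, ?_⟩
    ext1
    change bHom 0 (IwU.zpowGen n t) = (x : Iw p)
    rw [ht']
    ext
    · simp [ha]
    · simp

/-- The range `B_n` of the leaf gluing is infinite. [cite: MochizukiSemiAnbd2006, Def 2.4(iv) p.26] -/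
theorem infinite_range_lowHom (n : ℕ) : ((lowHom (p := p) n).toMonoidHom.range : Set (Leaf (p := p) n)).Infinite :=
  Set.infinite_range_of_injective (lowHom_injective n)

/-- **Malnormality of the leaf branch group**: for `x ∈ Leaf n` outside `B_n`,
`B_n ∩ x B_n x⁻¹ = 1` (inside `P`: `x ∉ T_0`, and `T_0 ∩ x T_0 x⁻¹ = 1` by abc-iut-w5-d236's torus malnormality).
[cite: MochizukiSemiAnbd2006, Def 2.4(iv) p.26] -/
theorem range_lowHom_inf_conj_eq_bot {n : ℕ} (x : Leaf (p := p) n)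
    (hx : x ∉ (lowHom (p := p) n).toMonoidHom.range) :
    (lowHom (p := p) n).toMonoidHom.range ⊓
      ((lowHom (p := p) n).toMonoidHom.range.map (MulAut.conj x).toMonoidHom) = ⊥ := by
  have hxT : (x : Iw p) ∉ (bHom (0 : ℤ_[p])).toMonoidHom.range := fun h => by
    apply hx
    rw [mem_range_lowHom_iff]
    have := (mem_range_bHom_iff 0 (x : Iw p)).1 h
    rw [this, zero_mul]
  have key := range_bHom_inf_conj_eq_bot_of_not_mem (0 : ℤ_[p]) hxT
  rw [eq_bot_iff]
  rintro z ⟨hz, ⟨y, hy, rfl⟩⟩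
  rw [Subgroup.mem_bot]
  have hzP : ((MulAut.conj x).toMonoidHom y : Iw p) ∈ (bHom (0 : ℤ_[p])).toMonoidHom.range ⊓
      ((bHom (0 : ℤ_[p])).toMonoidHom.range.map (MulAut.conj (x : Iw p)).toMonoidHom) :=
    ⟨coe_mem_range_bHom_zero_of_mem_range hz,
      ⟨(y : Iw p), coe_mem_range_bHom_zero_of_mem_range hy, rfl⟩⟩
  rw [key, Subgroup.mem_bot] at hzP
  ext1
  exact hzP

/-- The relative index of a subgroup meeting the infinite `B_n` trivially is `0` (= infinite index) — the
aloofness clause of `IsEstrangedEdge` at the leaf. [cite: MochizukiSemiAnbd2006, Def 2.4(iv) p.26] -/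
theorem relIndex_range_lowHom_eq_zero {n : ℕ} {H : Subgroup (Leaf (p := p) n)}
    (h : (lowHom (p := p) n).toMonoidHom.range ⊓ H = ⊥) :
    H.relIndex (lowHom (p := p) n).toMonoidHom.range = 0 := by
  haveI : Infinite ((lowHom (p := p) n).toMonoidHom.range) := (infinite_range_lowHom n).to_subtype
  rw [Subgroup.relIndex, show H.subgroupOf (lowHom (p := p) n).toMonoidHom.range = ⊥ from ?_,
    Subgroup.index_bot]
  · exact Nat.card_eq_zero_of_infinite
  · rw [eq_bot_iff]
    intro z hz
    rw [Subgroup.mem_bot]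
    have : (z : Leaf (p := p) n) ∈ (lowHom (p := p) n).toMonoidHom.range ⊓ H := ⟨z.2, hz⟩
    rw [h, Subgroup.mem_bot] at this
    exact Subtype.ext this

end Iw

end Literature.AnabelianGeometry.SemiGraphs

end
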